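import Summits.ResolutionOfSingularities.ResolutionOfSingularities.Theorems.FrobeniusClosingPatchingRelPerfectMonomialFormat
import Summits.ResolutionOfSingularities.ResolutionOfSingularities.Theorems.FrobeniusClosingPatchingRelPerfectMonomialSupPowContraction
import HarnessLib

/-!
# Crux `PatchingRelPerfect` (stmt-ResolutionOfSingularities-16161), chain w52 — monomial rung
# «R-mono», instance M1₂: `(x^α) + 𝔪ᴺ ∈ 𝒞` for EVERY exponent vector `α` and EVERY `N` (fact-free)

[OURS · L1 W5.2 · R-mono (M1₂), CHAIN v1.7 §2 row stub-2] The first INFINITE FAMILY OF MEMBERS OF ALL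
EXCEPTIONAL DEPTHS of the core's `𝔪`-primary stratum, kernel-checked with no literature fact: for a
regular local ring `S` of any dimension with regular system of parameters `x₁, …, xₙ`, every exponent
vector `α` and every `N`, the ideal `I = (x^α) + 𝔪ᴺ` (e.g. `(x₀ᵃx₁ᵇ) + 𝔪^{a+b+ℓ}`: exceptional depth
`ℓ`, non-regular initial scheme as soon as two `α_j` are positive) has a companion `Q ⊇ 𝔪ᵐ` with
`Bl_{I·Q} Spec S` regular, hence the conclusion of the open core `stub_atomDimFourBlowup` for every
blowing up along `I`.

Route: on `X = Bl_𝔪 Spec S` the format of M1 (`…MonomialFormat.lean`, p506672: `hasSNC_coordinateHyperplanes`,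
`comap_monomialIdeal_eq_transformExp`) reads `I𝒪_X = Π_j D̂_j^{α_j} · ℰ^{|α|} ⊔ ℰᴺ` — a monomial PLUS A
POWER OF ONE BOUNDARY DIVISOR in the simple normal crossings system `D̂₁, …, D̂ₙ, ℰ` — and res-type-049's
END-GAME `MonomialCleanup.atomConclusion_of_sup_pow` / `companion_of_sup_pow`
(`…MonomialSupPowContraction.lean`: res-L1-w52-stub-4's pair principalization + M3 + D5) contracts the
tower.  PROVED:

* `DepthTargets.monomialSupPow_format` — the format `((x^α) + 𝔪ᴺ)𝒪_X = monomialIdeal A_α ⊔ ℰᴺ` on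
  `Bl_𝔪 Spec S` with its snc and cosupport data;
* `DepthTargets.companion_monomial_sup_pow_maximalIdeal` — `(x^α) + 𝔪ᴺ ∈ 𝒞`;
* `DepthTargets.coreRung_monomial_sup_pow_maximalIdeal` — the core's conclusion for every blowing up
  along `(x^α) + 𝔪ᴺ`; `DepthTargets.atomDimFourBlowupAt_monomial_sup_pow_maximalIdeal` — the registered
  core's binder shape restricted to the family (dimension / characteristic / completeness / residue
  field / off-fibre hypotheses unused).

Fact-free, every dimension; FORMAT evidence for the core (CHAIN §1 (A)); nothing here is a statement of
the manuscript under review.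

## References

* J. Kollár, *Lectures on Resolution of Singularities* (2007), (3.111) Step 3. [Kollar2007]
* R. Goward, *A simple algorithm for principalization of monomial ideals*, Trans. AMS 357 (2005), §2.
  [Goward2005]
* The Stacks Project, Tags 080A, 080B. [StacksProject]
-/

-- `Summit.<Summit>.<Sub>.Theorems` with `Sub = Summit` (single-conjunct summit, D-0017)
set_option linter.dupNamespace false

noncomputable section

open CategoryTheory AlgebraicGeometry Literature.AlgebraicGeometry.Resolution
open IsLocalRing TopologicalSpace

namespace Summit.ResolutionOfSingularities.ResolutionOfSingularities.Theorems

namespace DepthTargets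

universe u

section Format

variable {S : Type u} [CommRing S] [IsRegularLocalRing S] {n : ℕ} (x : Fin n → S)
  (hx : Ideal.span (Set.range x) = maximalIdeal S) (hn : (maximalIdeal S).spanFinrank = n)

include hx hn in
/-- **FORMAT of `(x^α) + 𝔪ᴺ` on `X = Bl_𝔪 Spec S`**: with `g : X → Spec S` the blowing up of `𝔪`
(`X` Noetherian), there are an exponent list `A` on a simple normal crossings boundary of `X` (the strict
transforms of the coordinate hyperplanes and the exceptional divisor `ℰ`) containing `ℰ`, with
`((x^α) + 𝔪ᴺ)𝒪_X = monomialIdeal A ⊔ ℰᴺ` and the cosupport of the right-hand side over the closed point.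
[cite: Kollar2007, (3.111) Step 3] -/
theorem monomialSupPow_format (α : Fin n → ℕ) (N : ℕ) :
    ∃ (A : List ((affineBlowup (Ideal.span (Set.range x))).IdealSheafData × ℕ))
      (ℰ : (affineBlowup (Ideal.span (Set.range x))).IdealSheafData),
      HasSNC (boundaryOf A) ∧ ℰ ∈ boundaryOf A ∧
      (affineBlowup.idealSheaf (Ideal.span {∏ j, x j ^ α j} ⊔ maximalIdeal S ^ N)).comap
          (affineBlowup.π (Ideal.span (Set.range x))) = ⊤ * (monomialIdeal A ⊔ ℰ ^ N) ∧
      ((monomialIdeal A ⊔ ℰ ^ N).support : Set (affineBlowup (Ideal.span (Set.range x)))) ⊆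
        affineBlowup.π (Ideal.span (Set.range x)) ⁻¹' {closedPoint S} := by
  classical
  -- the coordinate hyperplanes downstairs and their stratum `T`
  set E₀ : Fin n → (Spec (.of S)).IdealSheafData :=
    fun j => affineBlowup.idealSheaf (Ideal.span {x j}) with hE₀
  set T : Finset (Spec (.of S)).IdealSheafData := Finset.univ.image E₀ with hT
  set Eα : List ((Spec (.of S)).IdealSheafData × ℕ) := List.ofFn fun j => (E₀ j, α j) with hEα
  have hbd : boundaryOf Eα = List.ofFn E₀ := by
    simp [hEα, boundaryOf, List.map_ofFn, Function.comp_def]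
  have hsnc₀ : HasSNC (List.ofFn E₀) := hasSNC_coordinateHyperplanes x hx hn
  have hTmem : ∀ K ∈ T, K ∈ List.ofFn E₀ := by
    intro K hK
    obtain ⟨j, -, rfl⟩ := Finset.mem_image.mp hK
    exact (List.mem_ofFn' _ _).mpr ⟨j, rfl⟩
  have hTsup : T.sup id = affineBlowup.idealSheaf (maximalIdeal S) :=
    finsetSup_idealSheaf_span_singleton x hx T fun K => by
      rw [hT, Finset.mem_image]
      exact ⟨fun ⟨j, _, h⟩ => ⟨j, h⟩, fun ⟨j, h⟩ => ⟨j, Finset.mem_univ _, h⟩⟩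
  set M : Ideal S := Ideal.span (Set.range x) with hMdef
  have hg : IsBlowup (affineBlowup.π M) (affineBlowup.idealSheaf (maximalIdeal S)) := by
    rw [← hx]; exact affineBlowup.isBlowup M
  have hgT : IsBlowup (affineBlowup.π M) (T.sup id) := by rw [hTsup]; exact hg
  -- the data upstairs: `A = transformExp E_α g T 0`, `ℰ = (⊔ T)𝒪_X`
  refine ⟨transformExp Eα (affineBlowup.π M) T 0, (T.sup id).comap (affineBlowup.π M), ?_, ?_, ?_, ?_⟩
  · exact hasSNC_boundaryOf_transformExp (hbd.symm ▸ hsnc₀) (fun K hK => hbd.symm ▸ hTmem K hK) hgT 0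
  · rw [boundaryOf_transformExp]
    exact List.mem_append_right _ (List.mem_singleton_self _)
  · -- the format
    rw [Scheme.IdealSheafData.top_mul, idealSheaf_sup_eq, Scheme.IdealSheafData.comap_sup,
      idealSheaf_span_prod_pow_eq_monomialIdeal,
      comap_monomialIdeal_eq_transformExp (hbd.symm ▸ hsnc₀) (fun K hK => hbd.symm ▸ hTmem K hK) hgT,
      DepthOne.idealSheaf_pow, comap_pow, ← hTsup]
  · -- cosupport over the closed point: inside `V(ℰᴺ) = g⁻¹ V(𝔪ᴺ)`
    intro y hy
    have hle : affineBlowup.idealSheaf (maximalIdeal S ^ N) ≤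
        affineBlowup.idealSheaf (Ideal.span {∏ j, x j ^ α j} ⊔ maximalIdeal S ^ N) :=
      affineBlowup.idealSheaf_le_idealSheaf_iff.mpr le_sup_right
    have hfmt : (affineBlowup.idealSheaf (Ideal.span {∏ j, x j ^ α j} ⊔ maximalIdeal S ^ N)).comap
        (affineBlowup.π M) = monomialIdeal (transformExp Eα (affineBlowup.π M) T 0) ⊔
          (T.sup id).comap (affineBlowup.π M) ^ N := by
      rw [idealSheaf_sup_eq, Scheme.IdealSheafData.comap_sup, idealSheaf_span_prod_pow_eq_monomialIdeal,
        comap_monomialIdeal_eq_transformExp (hbd.symm ▸ hsnc₀) (fun K hK => hbd.symm ▸ hTmem K hK) hgT,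
        DepthOne.idealSheaf_pow, comap_pow, ← hTsup]
    rw [← hfmt] at hy
    have hy' : y ∈ (((affineBlowup.idealSheaf (maximalIdeal S ^ N)).comap (affineBlowup.π M)).support :
        Set (affineBlowup M)) :=
      Scheme.IdealSheafData.support_antitone (Scheme.IdealSheafData.comap_mono _ hle) hy
    rw [Scheme.IdealSheafData.support_comap] at hy'
    exact support_idealSheaf_subset_closedPoint (Q := maximalIdeal S ^ N) (n := N) le_rfl _ hy'

end Format

/-! ## The rung -/

section Rung

variable {S : Type u} [CommRing S] [IsRegularLocalRing S] {n : ℕ} (x : Fin n → S)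
  (hx : Ideal.span (Set.range x) = maximalIdeal S) (hn : (maximalIdeal S).spanFinrank = n)

include hx hn in
/-- **`(x^α) + 𝔪ᴺ` is in the companion class `𝒞`, for every `α` and every `N`** (fact-free, every
dimension): some `Bl_{((x^α) + 𝔪ᴺ)·Q} Spec S` with `Q ⊇ 𝔪ᵐ` is regular.
[cite: Kollar2007, (3.111) Step 3] [cite: StacksProject, Tag 080A] -/
theorem companion_monomial_sup_pow_maximalIdeal (α : Fin n → ℕ) (N : ℕ) :
    ∃ (Q : Ideal S) (m : ℕ), maximalIdeal S ^ m ≤ Q ∧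
      ∃ (B : Scheme.{u}) (b : B ⟶ Spec (.of S)),
        IsBlowup b (affineBlowup.idealSheaf ((Ideal.span {∏ j, x j ^ α j} ⊔ maximalIdeal S ^ N) * Q)) ∧
        Scheme.IsRegular B := by
  haveI : IsDomain S := isDomain_of_isRegularLocalRing S
  have hrsop : IsRsopPart x := by
    have h := isRsopPart_comp_of_rsop hn x hx id Function.injective_id
    simpa using h
  have hI : Ideal.span {∏ j, x j ^ α j} ⊔ maximalIdeal S ^ N ≠ ⊥ := by
    intro h
    have hmem : ∏ j, x j ^ α j ∈ Ideal.span {∏ j, x j ^ α j} ⊔ maximalIdeal S ^ N :=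
      Ideal.mem_sup_left (Ideal.mem_span_singleton_self _)
    rw [h, Ideal.mem_bot] at hmem
    exact (Finset.prod_ne_zero_iff.mpr fun j _ => pow_ne_zero _ (hrsop.ne_zero j)) hmem
  obtain ⟨A, ℰ, hA, hℰ, hfmt, hsupp⟩ := monomialSupPow_format x hx hn α N
  haveI : IsNoetherian (affineBlowup (Ideal.span (Set.range x))) :=
    isNoetherian_of_isBlowup (affineBlowup.isBlowup _)
  have hg : IsBlowup (affineBlowup.π (Ideal.span (Set.range x))) (affineBlowup.idealSheaf (maximalIdeal S)) := by
    rw [← hx]; exact affineBlowup.isBlowup _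
  exact MonomialCleanup.companion_of_sup_pow hI hg
    (fun s hs => support_idealSheaf_subset_closedPoint (Q := maximalIdeal S) (n := 1) (by rw [pow_one]) s hs)
    A hA hℰ N (isLocallyPrincipal_top _) hfmt hsupp

include hx hn in
/-- **The core's conclusion for every blowing up along `(x^α) + 𝔪ᴺ`** (every `α`, every `N`; fact-free,
every dimension): a non-zero ideal sheaf cosupported in the closed fibre with regular blowing up.
[cite: Kollar2007, (3.111) Step 3] [cite: StacksProject, Tag 080A] -/
theorem coreRung_monomial_sup_pow_maximalIdeal (α : Fin n → ℕ) (N : ℕ)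
    (T : Scheme.{u}) (f : T ⟶ Spec (.of S))
    (hf : IsBlowup f (affineBlowup.idealSheaf (Ideal.span {∏ j, x j ^ α j} ⊔ maximalIdeal S ^ N))) :
    ∃ (J : T.IdealSheafData) (T' : Scheme.{u}) (π : T' ⟶ T), J ≠ ⊥ ∧
      (∀ t : T, t ∈ J.support → f.base t = closedPoint S) ∧
      IsBlowup π J ∧ Scheme.IsRegular T' := by
  haveI : IsDomain S := isDomain_of_isRegularLocalRing S
  have hrsop : IsRsopPart x := by
    have h := isRsopPart_comp_of_rsop hn x hx id Function.injective_id
    simpa using h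
  have hI : Ideal.span {∏ j, x j ^ α j} ⊔ maximalIdeal S ^ N ≠ ⊥ := by
    intro h
    have hmem : ∏ j, x j ^ α j ∈ Ideal.span {∏ j, x j ^ α j} ⊔ maximalIdeal S ^ N :=
      Ideal.mem_sup_left (Ideal.mem_span_singleton_self _)
    rw [h, Ideal.mem_bot] at hmem
    exact (Finset.prod_ne_zero_iff.mpr fun j _ => pow_ne_zero _ (hrsop.ne_zero j)) hmem
  exact atomConclusion_of_companion' hI (companion_monomial_sup_pow_maximalIdeal x hx hn α N) T f hf

/-- **The registered core's binder shape, restricted to the family `(x^α) + 𝔪ᴺ`.**  The dimension,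
characteristic, completeness, residue-field and off-fibre hypotheses are not used (underscored).
[cite: StacksProject, Tag 080A] -/
theorem atomDimFourBlowupAt_monomial_sup_pow_maximalIdeal (p : ℕ) (_hp : p.Prime) (S : Type)
    [CommRing S] [IsRegularLocalRing S] [CharP S p]
    [IsAdicComplete (IsLocalRing.maximalIdeal S) S]
    [PerfectField (IsLocalRing.ResidueField S)] (_hS : ringKrullDim S = (4 : ℕ))
    {n : ℕ} (x : Fin n → S) (hx : Ideal.span (Set.range x) = maximalIdeal S)
    (hn : (maximalIdeal S).spanFinrank = n) (α : Fin n → ℕ) (N : ℕ)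
    (_hI : Ideal.span {∏ j, x j ^ α j} ⊔ maximalIdeal S ^ N ≠ ⊥)
    (T : Scheme.{0}) (f : T ⟶ Spec (.of S))
    (hf : IsBlowup f (affineBlowup.idealSheaf (Ideal.span {∏ j, x j ^ α j} ⊔ maximalIdeal S ^ N)))
    (_hoff : ∀ t : T, f.base t ≠ closedPoint S → IsRegularLocalRing (T.presheaf.stalk t)) :
    ∃ (J : T.IdealSheafData) (T' : Scheme.{0}) (π : T' ⟶ T), J ≠ ⊥ ∧
      (∀ t : T, t ∈ J.support → f.base t = closedPoint S) ∧
      IsBlowup π J ∧ Scheme.IsRegular T' :=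
  coreRung_monomial_sup_pow_maximalIdeal x hx hn α N T f hf

end Rung

end DepthTargets

end Summit.ResolutionOfSingularities.ResolutionOfSingularities.Theorems

end
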